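import Summits.Ventures.PercRepro.Night2HighAssembly

/-!
# night-2: NO NEAR-FAT CLOSURE ⇒ NO LOADS — the load structure (gen 39)

A loaded target is a good target of a LOSSY BIG pair `(B_b, z′)` (gen 32's `exists_pair_of_dload_ne_zero'`); its covering set
`Q_b` has at most THREE active faces (the off-coloop part is a rank-2 set plus three points, `exists_rank_two_of_loss_ne_zero`, and a
point of the rank-2 part lies in the closure of the others — `card_faceOk_le_three_of_big`), each requesting
`7 / (6 (m + 2)) ≤ 7/36` when every thin member misses `m ≥ 4` points; so `L1 (Q_b) ≤ 7/12 < 11/18 ≤ capS (Q_b)` and the pair is not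
lossy: **`dload_eq_zero_of_four_thin`** — with no thin member missing exactly `3` points (no "near-fat" closure) EVERY target is
unloaded.  The fair share under no loads is Night2NoLoadsFair.  Paper: proofs/NIGHT-2-g39.md §8.
-/

namespace PercRepro.Shadow

open PercRepro.ThmH PercRepro.PerFlat

variable {α : Type*} [DecidableEq α] {M : Matroid α} [M.Finite] {G : Finset α}

/-- With every thin member missing `≥ 4` points there is no fat closure. -/
theorem fatClosures_eq_empty_of_four_thin (h4 : ∀ B ∈ thinMembers M 5 G, 4 ≤ (G \ clF M B).card) :
    fatClosures M 5 G 2 = ∅ := by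
  unfold fatClosures
  rw [Finset.image_eq_empty, Finset.filter_eq_empty_iff]
  intro B hB h
  have := h4 B hB
  omega

/-- **A lossy big pair has at most three active faces**: the off-coloop part is a rank-2 set `R` plus three points, and a point of
`R` lies in the closure of the other two. -/
theorem card_faceOk_le_three_of_big (hG : G ∈ flatsQ M (5 + 1)) (hd : (gr M \ G).card = 2)
    (hk : kColoops M G = 1) (hs : ∀ e ∈ gr M, ∀ f ∈ gr M, e ≠ f → rkN M {e, f} = 2)
    (hl : ∀ e ∈ gr M, M.Indep {e}) {B : Finset α} (hB : B ∈ thinMembers M 5 G)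
    (hbig : 5 ≤ (B \ coloops M G).card) {z : α} (hz : z ∈ G \ clF M B) (hloss : loss M 5 G B z ≠ 0) :
    ((insert z B \ coloops M G).filter (fun w => faceOk M G (insert z B) w)).card ≤ 3 := by
  obtain ⟨R, hRQ, hR2, hRcard⟩ := exists_rank_two_of_loss_ne_zero hG hd hk hs hl hB hbig hz hloss
  have hd' : (gr M \ G).card ≤ 5 := by omega
  have hGg : G ⊆ gr M := (mem_flatsQ.1 hG).1
  have hBG : B ⊆ G := subset_G_of_mem_thinMembers hB
  have hQG : insert z B ⊆ G := Finset.insert_subset (Finset.mem_sdiff.1 hz).1 hBG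
  have hKB : coloops M G ⊆ B := coloops_subset_of_mem_thinMembers hG hd' hB
  have hzB : z ∉ B := fun h => (Finset.mem_sdiff.1 hz).2 (subset_clF_of_subset_gr (hBG.trans hGg) h)
  have hzK : z ∉ coloops M G := fun h => hzB (hKB h)
  have hQ'card : 6 ≤ (insert z B \ coloops M G).card := by
    rw [insert_sdiff_coloops_eq hzK, Finset.card_insert_of_notMem (fun h => hzB (Finset.mem_sdiff.1 h).1)]
    omega
  have hR3 : 3 ≤ R.card := by omega
  have hRg : R ⊆ gr M := hRQ.trans (Finset.sdiff_subset.trans (hQG.trans hGg))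
  -- an active face is off `R`
  have hsub : (insert z B \ coloops M G).filter (fun w => faceOk M G (insert z B) w) ⊆
      (insert z B \ coloops M G) \ R := by
    intro w hw
    rw [Finset.mem_filter] at hw
    rw [Finset.mem_sdiff]
    refine ⟨hw.1, fun hwR => ?_⟩
    have hok := hw.2.2
    rw [Finset.mem_sdiff] at hok
    apply hok.2
    -- two other points of `R` span its line, which lies in `cl (Q.erase w)`
    have h2 : 1 < (R.erase w).card := by
      rw [Finset.card_erase_of_mem hwR]
      omega
    obtain ⟨r₁, hr₁, r₂, hr₂, hne⟩ := Finset.one_lt_card.1 h2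
    have hr₁R := Finset.mem_of_mem_erase hr₁
    have hr₂R := Finset.mem_of_mem_erase hr₂
    have hpair : ({r₁, r₂} : Finset α) ⊆ gr M := by
      intro e he
      rw [Finset.mem_insert, Finset.mem_singleton] at he
      rcases he with rfl | rfl
      · exact hRg hr₁R
      · exact hRg hr₂R
    have hRline : R ⊆ clF M {r₁, r₂} :=
      subset_clF_of_rkN_le_two_of_two_mem hs hRg hR2.le hr₁R hr₂R hne
        (subset_clF_of_subset_gr hpair (Finset.mem_insert_self _ _))
        (subset_clF_of_subset_gr hpair (Finset.mem_insert_of_mem (Finset.mem_singleton_self _)))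
    have hpairQ : ({r₁, r₂} : Finset α) ⊆ (insert z B).erase w := by
      intro e he
      rw [Finset.mem_insert, Finset.mem_singleton] at he
      rw [Finset.mem_erase]
      rcases he with rfl | rfl
      · exact ⟨(Finset.mem_erase.1 hr₁).1, (Finset.mem_sdiff.1 (hRQ hr₁R)).1⟩
      · exact ⟨(Finset.mem_erase.1 hr₂).1, (Finset.mem_sdiff.1 (hRQ hr₂R)).1⟩
    exact clF_mono hpairQ (hRline hwR)
  refine le_trans (Finset.card_le_card hsub) ?_
  rw [Finset.card_sdiff_of_subset hRQ]
  omega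

/-- **With every thin member missing `≥ 4` points no big pair is lossy**: its `≤ 3` faces request `≤ 7/36` each, below
`capS ≥ 11/18`. -/
theorem loss_eq_zero_of_four_thin (hG : G ∈ flatsQ M (5 + 1)) (hd : (gr M \ G).card = 2)
    (hk : kColoops M G = 1) (hs : ∀ e ∈ gr M, ∀ f ∈ gr M, e ≠ f → rkN M {e, f} = 2)
    (hl : ∀ e ∈ gr M, M.Indep {e}) (h4 : ∀ B ∈ thinMembers M 5 G, 4 ≤ (G \ clF M B).card) {B : Finset α}
    (hB : B ∈ thinMembers M 5 G) (hbig : 5 ≤ (B \ coloops M G).card) {z : α} (hz : z ∈ G \ clF M B) :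
    loss M 5 G B z = 0 := by
  by_contra hloss
  have hlt := capS_lt_L1_of_loss_ne_zero hloss
  have hQG : insert z B ⊆ G :=
    Finset.insert_subset (Finset.mem_sdiff.1 hz).1 (subset_G_of_mem_thinMembers hB)
  have hcap := capS_ge_eleven_eighteenths_two_one hd hk hQG
  have hA3 := card_faceOk_le_three_of_big hG hd hk hs hl hB hbig hz hloss
  have hL1 : L1 M 5 G (insert z B) ≤ 7 / 12 := by
    rw [L1_eq_sum_req_faces hG hd]
    have hterm : ∀ w ∈ (insert z B \ coloops M G).filter (fun w => faceOk M G (insert z B) w),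
        req M 5 ((insert z B).erase w) ≤ 7 / 36 := by
      intro w hw
      have hthin : (insert z B).erase w ∈ thinMembers M 5 G := (Finset.mem_filter.1 hw).2.1
      rw [req_eq_of_thin hG hthin, hd]
      have hm := h4 _ hthin
      have hm' : (4 : ℚ) ≤ ((G \ clF M ((insert z B).erase w)).card : ℚ) := by exact_mod_cast hm
      unfold phiQ
      push_cast
      rw [div_le_div_iff₀ (by linarith) (by norm_num)]
      nlinarith
    calc ∑ w ∈ (insert z B \ coloops M G).filter (fun w => faceOk M G (insert z B) w), req M 5 ((insert z B).erase w)
        ≤ ∑ _w ∈ (insert z B \ coloops M G).filter (fun w => faceOk M G (insert z B) w), (7 / 36 : ℚ) :=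
          Finset.sum_le_sum hterm
      _ = (((insert z B \ coloops M G).filter (fun w => faceOk M G (insert z B) w)).card : ℚ) * (7 / 36) := by
          rw [Finset.sum_const, nsmul_eq_mul]
      _ ≤ 3 * (7 / 36) := by
          apply mul_le_mul_of_nonneg_right _ (by norm_num)
          exact_mod_cast hA3
      _ = 7 / 12 := by norm_num
  linarith

/-- **A lossy big pair has a near-fat face**: with no fat closure, some active face of `Q_b` misses exactly three points
(else the `≤ 3` faces request `≤ 7/36` each). -/
theorem exists_near_fat_face_of_big_loss_ne_zero (hG : G ∈ flatsQ M (5 + 1)) (hd : (gr M \ G).card = 2)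
    (hk : kColoops M G = 1) (hs : ∀ e ∈ gr M, ∀ f ∈ gr M, e ≠ f → rkN M {e, f} = 2)
    (hl : ∀ e ∈ gr M, M.Indep {e}) (hnf : fatClosures M 5 G 2 = ∅) {B : Finset α}
    (hB : B ∈ thinMembers M 5 G) (hbig : 5 ≤ (B \ coloops M G).card) {z : α} (hz : z ∈ G \ clF M B)
    (hloss : loss M 5 G B z ≠ 0) :
    ∃ w ∈ insert z B \ coloops M G, faceOk M G (insert z B) w ∧ (G \ clF M ((insert z B).erase w)).card = 3 := by
  by_contra hnone
  have hlt := capS_lt_L1_of_loss_ne_zero hloss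
  have hQG : insert z B ⊆ G :=
    Finset.insert_subset (Finset.mem_sdiff.1 hz).1 (subset_G_of_mem_thinMembers hB)
  have hcap := capS_ge_eleven_eighteenths_two_one hd hk hQG
  have hA3 := card_faceOk_le_three_of_big hG hd hk hs hl hB hbig hz hloss
  have hL1 : L1 M 5 G (insert z B) ≤ 7 / 12 := by
    rw [L1_eq_sum_req_faces hG hd]
    have hterm : ∀ w ∈ (insert z B \ coloops M G).filter (fun w => faceOk M G (insert z B) w),
        req M 5 ((insert z B).erase w) ≤ 7 / 36 := by
      intro w hw
      rw [Finset.mem_filter] at hw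
      have hthin : (insert z B).erase w ∈ thinMembers M 5 G := hw.2.1
      have h3 := three_le_card_sdiff_of_nonfat hnf hthin
      have hne3 : (G \ clF M ((insert z B).erase w)).card ≠ 3 := fun h => hnone ⟨w, hw.1, hw.2, h⟩
      have hm : 4 ≤ (G \ clF M ((insert z B).erase w)).card := by omega
      rw [req_eq_of_thin hG hthin, hd]
      have hm' : (4 : ℚ) ≤ ((G \ clF M ((insert z B).erase w)).card : ℚ) := by exact_mod_cast hm
      unfold phiQ
      push_cast
      rw [div_le_div_iff₀ (by linarith) (by norm_num)]
      nlinarith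
    calc ∑ w ∈ (insert z B \ coloops M G).filter (fun w => faceOk M G (insert z B) w), req M 5 ((insert z B).erase w)
        ≤ ∑ _w ∈ (insert z B \ coloops M G).filter (fun w => faceOk M G (insert z B) w), (7 / 36 : ℚ) :=
          Finset.sum_le_sum hterm
      _ = (((insert z B \ coloops M G).filter (fun w => faceOk M G (insert z B) w)).card : ℚ) * (7 / 36) := by
          rw [Finset.sum_const, nsmul_eq_mul]
      _ ≤ 3 * (7 / 36) := by
          apply mul_le_mul_of_nonneg_right _ (by norm_num)
          exact_mod_cast hA3
      _ = 7 / 12 := by norm_num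
  linarith

/-- **THE NEAR-FAT LOAD LEMMA**: with no fat closure, a loaded target has all but at most three of its off-coloop points
inside a thin-member closure missing exactly three points of `G` (the near-fat face of its lossy big pair). -/
theorem exists_near_fat_of_dload_ne_zero (hG : G ∈ flatsQ M (5 + 1)) (hd : (gr M \ G).card = 2)
    (hk : kColoops M G = 1) (hs : ∀ e ∈ gr M, ∀ f ∈ gr M, e ≠ f → rkN M {e, f} = 2)
    (hl : ∀ e ∈ gr M, M.Indep {e}) (hnf : fatClosures M 5 G 2 = ∅) {T : Finset α}
    (hne : dload M 5 G (bigP M G) (dshGT2 M 5 G) T ≠ 0) :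
    ∃ B₀ ∈ thinMembers M 5 G, (G \ clF M B₀).card = 3 ∧ ((T \ coloops M G) \ clF M B₀).card ≤ 3 := by
  have hfat : (fatClosures M 5 G 2).card ≤ 1 := by
    rw [hnf, Finset.card_empty]
    exact zero_le_one
  obtain ⟨B, hB, hbig, z, hz, hloss, hcase⟩ := exists_pair_of_dload_ne_zero' hG hd hk hs hl hfat hne
  obtain ⟨w, hw, hok, h3⟩ := exists_near_fat_face_of_big_loss_ne_zero hG hd hk hs hl hnf hB hbig hz hloss
  have hGg : G ⊆ gr M := (mem_flatsQ.1 hG).1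
  have hQG : insert z B ⊆ G :=
    Finset.insert_subset (Finset.mem_sdiff.1 hz).1 (subset_G_of_mem_thinMembers hB)
  refine ⟨(insert z B).erase w, hok.1, h3, ?_⟩
  have hface : (insert z B).erase w ⊆ clF M ((insert z B).erase w) :=
    subset_clF_of_subset_gr ((Finset.erase_subset _ _).trans (hQG.trans hGg))
  -- `T ∖ (Q.erase w)` has at most three points: `w` and the one or two added points
  have key : ∀ S : Finset α, S ⊆ T → ((T \ coloops M G) \ clF M ((insert z B).erase w)).card ≤
      (T \ ((insert z B).erase w)).card := fun _ _ =>
    Finset.card_le_card (fun e he => by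
      rw [Finset.mem_sdiff] at he ⊢
      exact ⟨(Finset.mem_sdiff.1 he.1).1, fun h => he.2 (hface h)⟩)
  refine le_trans (key T (Finset.Subset.refl _)) ?_
  rcases hcase with ⟨-, x, -, rfl⟩ | ⟨-, p, -, rfl⟩
  · have hsub : insert x (insert z B) \ (insert z B).erase w ⊆ {x, w} := by
      intro e he
      rw [Finset.mem_sdiff, Finset.mem_insert, Finset.mem_erase, not_and] at he
      rw [Finset.mem_insert, Finset.mem_singleton]
      rcases he.1 with h | h
      · exact Or.inl h
      · exact Or.inr (by_contra fun hne' => he.2 hne' h)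
    exact le_trans (Finset.card_le_card hsub) (le_trans (Finset.card_le_two) (by norm_num))
  · have hsub : insert p.1 (insert p.2 (insert z B)) \ (insert z B).erase w ⊆ {p.1, p.2, w} := by
      intro e he
      rw [Finset.mem_sdiff, Finset.mem_insert, Finset.mem_insert, Finset.mem_erase, not_and] at he
      rw [Finset.mem_insert, Finset.mem_insert, Finset.mem_singleton]
      rcases he.1 with h | h | h
      · exact Or.inl h
      · exact Or.inr (Or.inl h)
      · exact Or.inr (Or.inr (by_contra fun hne' => he.2 hne' h))
    exact le_trans (Finset.card_le_card hsub) (Finset.card_le_three)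

/-- **NO NEAR-FAT CLOSURE ⇒ NO LOADS**: with every thin member missing `≥ 4` points every target is unloaded. -/
theorem dload_eq_zero_of_four_thin (hG : G ∈ flatsQ M (5 + 1)) (hd : (gr M \ G).card = 2)
    (hk : kColoops M G = 1) (hs : ∀ e ∈ gr M, ∀ f ∈ gr M, e ≠ f → rkN M {e, f} = 2)
    (hl : ∀ e ∈ gr M, M.Indep {e}) (h4 : ∀ B ∈ thinMembers M 5 G, 4 ≤ (G \ clF M B).card) (T : Finset α) :
    dload M 5 G (bigP M G) (dshGT2 M 5 G) T = 0 := by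
  by_contra hne
  have hfat : (fatClosures M 5 G 2).card ≤ 1 := by
    rw [fatClosures_eq_empty_of_four_thin h4, Finset.card_empty]
    exact zero_le_one
  obtain ⟨B, hB, hbig, z, hz, hloss, -⟩ := exists_pair_of_dload_ne_zero' hG hd hk hs hl hfat hne
  exact hloss (loss_eq_zero_of_four_thin hG hd hk hs hl h4 hB hbig hz)

end PercRepro.Shadow
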